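/-
HONEST FRAMING: certified error envelopes and provably optimal rounding/accumulation schemes for
low-precision formats under stated cost models; every table by two implementations; no hardware
or vendor claims.
-/
import Summits.Ventures.CertifiedArithmetic.LowPrec.OptDemotionRoutingTopGood
import Summits.Ventures.CertifiedArithmetic.LowPrec.OptDemotionRoutingClosure

/-!
# The demotion law (Theorem T8), part 10b: opt's LARGEST-COMMON-BIT REDUCTION (R29)

opt gen 15 (gen15/README §3, OPTIMA.md T8 (R29)).  In the un-carry descent of part 8m a top pair
`(o | e) = (n + ½ | m - n)` with a common bit is improved by un-carrying SOME common bit `β = 2^k`;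
the move that re-assembles the parent's leading bit (case `n + 2^k ≥ 2^(q-1)`, i.e.
`o = 2^(q-1) - β + A + ½` with `A < β`, `e = β + B`) is paid for by opt's two-tree inequality
`TT q` (part 8l), stated there for every `B < 2^(q-1) - β` with bit `k` clear.  R29: un-carry the
LARGEST common bit instead.  Then `o` carries every bit from `2^(q-2)` down to `β`, so a bit of `B`
at or above `2β` would be a larger common bit — hence `B < β` is forced, and the descent needs the
two-tree inequality only for `A < β` AND `B < β`: `TTlow q`.  THIS FILE proves
`TTlow q → AllTopGood q` (part 10a) `→ LRL q →` the routing conjecture for every shape and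
**Conjecture D for every tree** (`conjectureD_of_TTlow`), and the matching certificate test
`ttCheckLow` (the `E`-rows only for `B < 2^k`; at `q = 6`: 31 e-side targets instead of 77, the
never-closing `E(β = 1/32, B = 13/16)` among the dropped) with `TTlow_of_checks` /
`conjectureD_of_checksLow` for per-`q` certificate files.  `TT q → TTlow q` (`TTlow_of_TT`).
-/

namespace Summit.Ventures.CertifiedArithmetic.LowPrec.Opt

open Literature.ComputerArithmetic.JeannerodRump2018
open Literature.ComputerArithmetic.JeannerodRump2018.SumTree

/-! ## The two-tree inequality for small offsets -/

/-- **opt's TWO-TREE INEQUALITY FOR SMALL OFFSETS (R29 form of (TT))**, budget units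
(`σ = 2^(q-1)`, half ulp `½`): for all subtrees `a, b`, every level `β = 2^k` (`k + 2 ≤ q`), every
`A < β` AND every `B < β` (vs. `B < σ - β` with bit `k` clear in `TT q`), with
`o = σ - β + A + ½`, `e = β + B`:
`BR_a(o) + BR_b(e) ≤ max (BR_a(o + β - ½) + BR_b(e - β + ½)) (BR_a(o - β) + BR_b(e + β))`. -/
def TTlow (q : ℕ) : Prop :=
  ∀ (a b : SumTree) (k A B : ℕ), k + 2 ≤ q → A < 2 ^ k → B < 2 ^ k →
    let β : ℚ := (2 : ℚ) ^ k
    let o : ℚ := (2 : ℚ) ^ (q - 1) - β + A + 1 / 2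
    let e : ℚ := β + B
    treeBRv q a o + treeBRv q b e ≤
      max (treeBRv q a (o + β - 1 / 2) + treeBRv q b (e - β + 1 / 2))
        (treeBRv q a (o - β) + treeBRv q b (e + β))

section R29

variable {q : ℕ}

/-- `TT q` implies its small-offset part. -/
theorem TTlow_of_TT (hTT : TT q) : TTlow q := by
  intro a b k A B hk hA hB
  have h1 : B + 2 ^ k < 2 ^ (q - 1) := by
    have : 2 ^ (k + 1) ≤ 2 ^ (q - 1) := Nat.pow_le_pow_right (by norm_num) (by omega)
    rw [pow_succ] at this; omega
  exact hTT a b k A B hk hA h1 (Nat.testBit_lt_two_pow hB)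

/-! ## Bits just below a power of two -/

/-- A natural `≥ 2^k` has a set bit at or above `k`. -/
theorem exists_testBit_of_two_pow_le {B k : ℕ} (h : 2 ^ k ≤ B) : ∃ j, k ≤ j ∧ B.testBit j = true := by
  by_contra hne
  push Not at hne
  have : B < 2 ^ k := Nat.lt_pow_two_of_testBit B fun i hi => by
    have := hne i hi; simpa using this
  omega

/-- Just below a power of two all high bits are set: `2^(q-1) - 2^k ≤ n < 2^(q-1)` and
`k ≤ j < q - 1` give bit `j` of `n`. -/
theorem testBit_of_sub_le {q n k j : ℕ} (hn : n < 2 ^ (q - 1)) (hn' : 2 ^ (q - 1) - 2 ^ k ≤ n)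
    (hkj : k ≤ j) (hj : j < q - 1) : n.testBit j = true := by
  set c := 2 ^ (q - 1) - 1 - n with hc
  have hc' : c < 2 ^ (q - 1) := by omega
  have hck : c < 2 ^ k := by omega
  have hcj : c.testBit j = false :=
    Nat.testBit_lt_two_pow (lt_of_lt_of_le hck (Nat.pow_le_pow_right (by norm_num) hkj))
  have hn_eq : n = 2 ^ (q - 1) - (c + 1) := by omega
  rw [hn_eq, Nat.testBit_two_pow_sub_succ hc' j]
  simp [hj, hcj]

/-! ## The descent with the largest common bit -/

/-- THE R29 DESCENT STEP: if all top pairs with fewer bits are good (both orientations), so is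
`(n + ½ | m - n)` — partition end, or un-carry the LARGEST common bit `2^k` by (MC)² (case
`n + 2^k < 2^(q-1)`) or by `TTlow` (case `n + 2^k ≥ 2^(q-1)`, where maximality forces
`m - n - 2^k < 2^k`). -/
theorem topGood_step_low (hq : 2 ≤ q) (hTT : TTlow q) (a b : SumTree) {m : ℕ} (hm : 2 ^ (q - 1) ≤ m)
    (hm' : m < 2 ^ q) {n : ℕ} (hn : n < 2 ^ (q - 1)) (hnm : n ≤ m)
    (ih : ∀ n' : ℕ, n' < 2 ^ (q - 1) → n' ≤ m →
      (natBits n').card + (natBits (m - n')).card < (natBits n).card + (natBits (m - n)).card →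
      TopGood q a b m n' ∧ TopGood q b a m n') :
    TopGood q a b m n := by
  classical
  have hq1 : 1 ≤ q := le_trans (by norm_num) hq
  unfold TopGood
  by_cases hdisj : Disjoint (natBits n) (natBits (m - n))
  · exact topPair_partition hq1 a b hm hm' hn hnm hdisj
  · ---- the LARGEST common bit k
    have hIne : (natBits n ∩ natBits (m - n)).Nonempty := by
      obtain ⟨x, h1, h2⟩ := Finset.not_disjoint_iff.1 hdisj
      exact ⟨x, Finset.mem_inter.2 ⟨h1, h2⟩⟩
    obtain ⟨kz, hkzI, hkzmax⟩ : ∃ kz ∈ natBits n ∩ natBits (m - n),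
        ∀ j ∈ natBits n ∩ natBits (m - n), j ≤ kz :=
      ⟨_, Finset.max'_mem _ hIne, fun j hj => Finset.le_max' _ j hj⟩
    obtain ⟨hk'n, hk'e⟩ := Finset.mem_inter.1 hkzI
    obtain ⟨k, hkn, hkk⟩ := mem_natBits.1 hk'n
    subst hkk
    have hkmax : ∀ j : ℕ, (j : ℤ) ∈ natBits n → (j : ℤ) ∈ natBits (m - n) → j ≤ k := by
      intro j hj1 hj2
      have := hkzmax _ (Finset.mem_inter.2 ⟨hj1, hj2⟩)
      exact_mod_cast this
    have hke : (m - n).testBit k = true := natCast_mem_natBits.1 hk'e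
    have h2n : 2 ^ k ≤ n := Nat.ge_two_pow_of_testBit hkn
    have h2e : 2 ^ k ≤ m - n := Nat.ge_two_pow_of_testBit hke
    have hkq : k + 2 ≤ q := by
      have := (natBits_lt hn hk'n).2
      have : k < q - 1 := by exact_mod_cast this
      omega
    -- arithmetic facts about the powers (atoms for `omega`)
    have hg0 : 0 < 2 ^ k := Nat.two_pow_pos k
    have hd0 : 0 < 2 ^ (q - 1) := Nat.two_pow_pos _
    have hhalf : 2 ^ (q - 1) + 2 ^ (q - 1) = 2 ^ q := (two_pow_eq_half_add_half hq1).symm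
    have hkle : 2 ^ k ≤ 2 ^ (q - 1) := Nat.pow_le_pow_right (by norm_num) (by omega)
    -- names for the values
    set H : ℚ := (2 : ℚ) ^ ((q : ℤ) - 1) with hH
    set β : ℚ := (2 : ℚ) ^ k with hβ
    have hβz : (2 : ℚ) ^ (k : ℤ) = β := zpow_natCast 2 k
    set o : ℚ := (n : ℚ) + 1 / 2 with ho
    set e : ℚ := ((m - n : ℕ) : ℚ) with hedef
    have he : e = (m : ℚ) - n := by rw [hedef]; push_cast [Nat.cast_sub hnm]; ring
    -- bit counts of the moved states
    have hc1 : (natBits (n - 2 ^ k)).card + 1 = (natBits n).card := by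
      rw [natBits_sub_pow hkn, Finset.card_erase_of_mem hk'n]
      have := Finset.card_pos.2 (⟨_, hk'n⟩ : (natBits n).Nonempty); omega
    have hc2 : (natBits (m - n - 2 ^ k)).card + 1 = (natBits (m - n)).card := by
      rw [natBits_sub_pow hke, Finset.card_erase_of_mem hk'e]
      have := Finset.card_pos.2 (⟨_, hk'e⟩ : (natBits (m - n)).Nonempty); omega
    have hc3 : (natBits (n + 2 ^ k)).card ≤ (natBits n).card := card_natBits_add_pow_le hkn
    have hc4 : (natBits (m - n + 2 ^ k)).card ≤ (natBits (m - n)).card := card_natBits_add_pow_le hke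
    -- the move M2 = (n - 2^k | m - n + 2^k), same orientation, is good by IH
    have hM2 : H + treeBRv q a (o - β) + treeBRv q b (e + β) ≤ treeBR q (.node a b) (natBits m) := by
      have h := (ih (n - 2 ^ k) (by omega) (by omega) (by
        rw [show m - (n - 2 ^ k) = m - n + 2 ^ k by omega]; omega)).1
      unfold TopGood at h
      have e1 : ((n - 2 ^ k : ℕ) : ℚ) + 1 / 2 = o - β := by rw [ho, hβ]; push_cast [Nat.cast_sub h2n]; ring
      have e2 : ((m - (n - 2 ^ k) : ℕ) : ℚ) = e + β := by
        rw [he, hβ, show m - (n - 2 ^ k) = m - n + 2 ^ k by omega]; push_cast [Nat.cast_sub hnm]; ring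
      rw [e1, e2] at h; exact h
    -- floats
    have hoF : IsQFloat q o := isQFloat_half hq1 hn
    have heF : IsQFloat q e := by
      rw [hedef]; exact isQFloat_natCast (le_trans Nat.one_le_two_pow h2e) (by omega)
    have hko : (k : ℤ) ∈ bitsOf o := by rw [ho, bitsOf_half]; exact Finset.mem_insert_of_mem hk'n
    have hke' : (k : ℤ) ∈ bitsOf e := by rw [hedef, bitsOf_natCast]; exact hk'e
    have heβF : IsQFloat q (e + β) := by
      have : e + β = ((m - n + 2 ^ k : ℕ) : ℚ) := by rw [hedef, hβ]; push_cast; ring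
      rw [this]; exact isQFloat_natCast (by omega) (by omega)
    -- MC at e (always available)
    have hMCe := treeBRv_midconvex b heF hke' (by rw [hβz]; exact heβF)
    rw [hβz] at hMCe
    by_cases hA : n + 2 ^ k < 2 ^ (q - 1)
    · ---- case o + β < σ: moves M1, M2 and (MC)²
      have hoβF : IsQFloat q (o + β) := by
        have : o + β = ((n + 2 ^ k : ℕ) : ℚ) + 1 / 2 := by rw [ho, hβ]; push_cast; ring
        rw [this]; exact isQFloat_half hq1 hA
      have hMCo := treeBRv_midconvex a hoF hko (by rw [hβz]; exact hoβF)
      rw [hβz] at hMCo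
      -- M1 = (n + 2^k | m - n - 2^k) is good by IH
      have hM1 : H + treeBRv q a (o + β) + treeBRv q b (e - β) ≤ treeBR q (.node a b) (natBits m) := by
        have h := (ih (n + 2 ^ k) hA (by omega) (by
          rw [show m - (n + 2 ^ k) = m - n - 2 ^ k by omega]; omega)).1
        unfold TopGood at h
        have e1 : ((n + 2 ^ k : ℕ) : ℚ) + 1 / 2 = o + β := by rw [ho, hβ]; push_cast; ring
        have e2 : ((m - (n + 2 ^ k) : ℕ) : ℚ) = e - β := by
          rw [he, hβ]; push_cast [Nat.cast_sub (show n + 2 ^ k ≤ m by omega)]; ring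
        rw [e1, e2] at h; exact h
      linarith
    · ---- case o + β ≥ σ: the leading bit is re-assembled; moves M1′, M2 and TTlow
      have hA' : 2 ^ (q - 1) ≤ n + 2 ^ k := not_lt.1 hA
      -- then e < σ
      have helt : m - n < 2 ^ (q - 1) := by
        by_contra hge
        have hge : 2 ^ (q - 1) ≤ m - n := not_lt.1 hge
        have htop : (m - n).testBit (q - 1) = true := by
          have := pred_mem_natBits hq1 hge (by omega : m - n < 2 ^ q)
          have e1 : ((q : ℤ) - 1) = ((q - 1 : ℕ) : ℤ) := by push_cast [Nat.cast_sub hq1]; ring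
          rw [e1] at this; exact natCast_mem_natBits.1 this
        have := add_pow_le_of_testBit htop hke (by omega)
        omega
      set A : ℕ := n - (2 ^ (q - 1) - 2 ^ k) with hAdef
      set B : ℕ := m - n - 2 ^ k with hBdef
      have hAlt : A < 2 ^ k := by omega
      have hBbit : B.testBit k = false := by
        have : (k : ℤ) ∉ natBits B := by
          rw [hBdef, natBits_sub_pow hke]; exact Finset.notMem_erase _ _
        by_contra h'
        exact this (natCast_mem_natBits.2 (by simpa using h'))
      -- R29: maximality of k forces B < β
      have hBlt : B < 2 ^ k := by
        by_contra hge
        obtain ⟨j, hkj, hjB⟩ := exists_testBit_of_two_pow_le (not_lt.1 hge)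
        have hjk : k < j := by
          rcases eq_or_lt_of_le hkj with h | h
          · rw [← h, hBbit] at hjB; exact absurd hjB (by simp)
          · exact h
        have hjq : j < q - 1 := by
          by_contra hle
          have : 2 ^ (q - 1) ≤ 2 ^ j := Nat.pow_le_pow_right (by norm_num) (not_lt.1 hle)
          have : 2 ^ j ≤ B := Nat.ge_two_pow_of_testBit hjB
          omega
        -- bit j of m - n (B = bits(m - n) minus k) and of n (all ones from k up to q - 2)
        have hje : (j : ℤ) ∈ natBits (m - n) := by
          have := natCast_mem_natBits.2 hjB
          rw [hBdef, natBits_sub_pow hke] at this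
          exact Finset.mem_of_mem_erase this
        have hjn : (j : ℤ) ∈ natBits n :=
          natCast_mem_natBits.2 (testBit_of_sub_le hn (by omega) hkj hjq)
        have := hkmax j hjn hje
        omega
      have hoTT : (2 : ℚ) ^ (q - 1) - β + A + 1 / 2 = o := by
        rw [ho, hAdef, hβ]
        push_cast [Nat.cast_sub (show 2 ^ (q - 1) - 2 ^ k ≤ n by omega), Nat.cast_sub hkle]
        ring
      have heTT : β + (B : ℚ) = e := by
        rw [he, hBdef, hβ]; push_cast [Nat.cast_sub h2e, Nat.cast_sub hnm]; ring
      have hT := hTT a b k A B hkq hAlt hBlt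
      simp only at hT
      rw [← hβ, hoTT, heTT] at hT
      -- M1′ = (B odd on b | n + 2^k on a) is good by IH (second orientation)
      have hM1' : H + treeBRv q b (e - β + 1 / 2) + treeBRv q a (o + β - 1 / 2) ≤
          treeBR q (.node a b) (natBits m) := by
        have hmB : m - B = n + 2 ^ k := by omega
        have h := (ih B (by omega) (by omega) (by rw [hmB]; omega)).2
        unfold TopGood at h
        have e1 : (B : ℚ) + 1 / 2 = e - β + 1 / 2 := by rw [← heTT]; ring
        have e2 : ((m - B : ℕ) : ℚ) = o + β - 1 / 2 := by rw [hmB, ho, hβ]; push_cast; ring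
        have hcomm : treeBR q (.node b a) (natBits m) = treeBR q (.node a b) (natBits m) := by
          unfold treeBR; exact treeBRw_node_comm q _ b a _
        rw [e1, e2, hcomm] at h
        exact h
      have hmax : max (treeBRv q a (o + β - 1 / 2) + treeBRv q b (e - β + 1 / 2))
          (treeBRv q a (o - β) + treeBRv q b (e + β)) ≤ treeBR q (.node a b) (natBits m) - H :=
        max_le (by linarith) (by linarith)
      linarith

/-- **THE R29 DESCENT** (opt (UC-II′) with the largest common bit, under `TTlow`): every top pair
is good, in both orientations. -/
theorem topGood_of_TTlow (hq : 2 ≤ q) (hTT : TTlow q) (a b : SumTree) {m : ℕ} (hm : 2 ^ (q - 1) ≤ m)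
    (hm' : m < 2 ^ q) :
    ∀ (μ n : ℕ), n < 2 ^ (q - 1) → n ≤ m → (natBits n).card + (natBits (m - n)).card ≤ μ →
      TopGood q a b m n ∧ TopGood q b a m n
  | 0, n, hn, hnm, hμ =>
      ⟨topGood_step_low hq hTT a b hm hm' hn hnm fun n' _ _ h => absurd h (by omega),
       topGood_step_low hq hTT b a hm hm' hn hnm fun n' _ _ h => absurd h (by omega)⟩
  | μ + 1, n, hn, hnm, hμ =>
      ⟨topGood_step_low hq hTT a b hm hm' hn hnm fun n' hn' hnm' h =>
          topGood_of_TTlow hq hTT a b hm hm' μ n' hn' hnm' (by omega),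
       topGood_step_low hq hTT b a hm hm' hn hnm fun n' hn' hnm' h =>
          (topGood_of_TTlow hq hTT a b hm hm' μ n' hn' hnm' (by omega)).symm⟩

/-- All top pairs are good from `TTlow q` (`q ≥ 2`). -/
theorem allTopGood_of_TTlow (hq : 2 ≤ q) (hTT : TTlow q) : AllTopGood q :=
  fun a b _ hm hm' n hn hnm => (topGood_of_TTlow hq hTT a b hm hm' _ n hn hnm le_rfl).1

/-- **opt's LOCAL ROUTING LEMMA FROM THE SMALL-OFFSET TWO-TREE INEQUALITY** (R29, `q ≥ 2`). -/
theorem LRL_of_TTlow (hq : 2 ≤ q) (hTT : TTlow q) : LRL q :=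
  LRL_of_allTopGood (le_trans (by norm_num) hq) (allTopGood_of_TTlow hq hTT)

/-- **THE ROUTING CONJECTURE FOR EVERY SHAPE FROM `TTlow`** (`q ≥ 2`). -/
theorem routingBound_of_TTlow (hq : 2 ≤ q) (hTT : TTlow q) (s : Shape) : RoutingBound q s :=
  routingBound_of_LRL (le_trans (by norm_num) hq) (LRL_of_TTlow hq hTT) s

/-- **CONJECTURE D FOR EVERY TREE FROM THE SMALL-OFFSET TWO-TREE INEQUALITY (opt R29)**: for
`q ≥ 2` with `TTlow q` — the two-tree inequality only for `A < β` and `B < β` — every `p ≥ 1`, any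
nearest roundings into `F(q, emin)` and `F(p, emin)`, and every summation tree of nonnegative
`F(q, emin)` data: `s ≤ Q_t · fl_p(ŝ)`, `Q_t = treeQf u_q t u_p`. -/
theorem conjectureD_of_TTlow {p : ℕ} (hp : 1 ≤ p) (hq : 2 ≤ q) (hTT : TTlow q) {emin : ℤ}
    {fl flp : ℚ → ℚ} (hfl : IsRoundNearest q emin fl) (hflp : IsRoundNearest p emin flp)
    (t : SumTree) (ht : ∀ x ∈ leaves t, IsFloat q emin x ∧ 0 ≤ x) :
    exact t ≤ treeQf (unitRoundoff q) t (unitRoundoff p) * flp (eval fl t) :=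
  conjectureD_of_LRL hp (le_trans (by norm_num) hq) (LRL_of_TTlow hq hTT) hfl hflp t ht

end R29

/-! ## The certificate test for `TTlow` -/

open Cone

/-- THE TEST FOR `TTlow q` (R29 targets): for every level `k ≤ q - 2` a weight `0 ≤ ρn ≤ ρd`,
`ρd > 0`, every `O`-row with `A < 2^k` and every `E`-row with `B < 2^k` (part 9d `ttCheck` asks
the `E`-rows for all `B < 2^(q-1) - 2^k` with bit `k` clear). -/
def ttCheckLow (q : ℕ) (rows : List (List ℤ)) (rho : List (ℕ × ℕ)) : Bool :=
  (List.range (q - 1)).all fun k =>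
    decide ((rho.getD k (0, 1)).1 ≤ (rho.getD k (0, 1)).2) && (decide (0 < (rho.getD k (0, 1)).2) &&
      ((List.range (2 ^ k)).all (fun A => oCheck q rows (rho.getD k (0, 1)).1 (rho.getD k (0, 1)).2 k A) &&
        (List.range (2 ^ k)).all fun B =>
          eCheck q rows (rho.getD k (0, 1)).1 (rho.getD k (0, 1)).2 k B))

/-- **`TTlow q` FROM A CONE-CLOSURE CERTIFICATE WITH THE R29 TARGETS**: if every tree's table is
in the cone of `rows` and `rows` pass `ttCheckLow`, the small-offset two-tree inequality holds. -/
theorem TTlow_of_checks {q : ℕ} {rows : List (List ℤ)} {rho : List (ℕ × ℕ)}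
    (htt : ttCheckLow q rows rho = true) (hall : ∀ t : SumTree, InCone rows (tab q t)) : TTlow q := by
  intro a b k A B hk hA hB
  have hk' : k ∈ List.range (q - 1) := List.mem_range.2 (by omega)
  have H := List.all_eq_true.1 htt k hk'
  simp only [Bool.and_eq_true, decide_eq_true_eq] at H
  obtain ⟨hρ, hρd, hO, hE⟩ := H
  have hO' := List.all_eq_true.1 hO A (List.mem_range.2 hA)
  have hE' := List.all_eq_true.1 hE B (List.mem_range.2 hB)
  have kO := oCheck_sound hO' (hall a)
  have kE := eCheck_sound hE' (hall b)
  have hρd' : (0 : ℚ) < (rho.getD k (0, 1)).2 := by exact_mod_cast hρd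
  have hρ' : ((rho.getD k (0, 1)).1 : ℚ) ≤ (rho.getD k (0, 1)).2 := by exact_mod_cast hρ
  exact tt_combine hρd' hρ' (Nat.cast_nonneg _) kO kE

/-- The R29 test is weaker than part 9d's: a certificate passing `ttCheck` passes `ttCheckLow`. -/
theorem ttCheckLow_of_ttCheck {q : ℕ} {rows : List (List ℤ)} {rho : List (ℕ × ℕ)}
    (htt : ttCheck q rows rho = true) : ttCheckLow q rows rho = true := by
  unfold ttCheckLow
  refine List.all_eq_true.2 fun k hk => ?_
  have hkq : k < q - 1 := List.mem_range.1 hk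
  have H := List.all_eq_true.1 htt k hk
  simp only [Bool.and_eq_true, decide_eq_true_eq] at H ⊢
  obtain ⟨hρ, hρd, hO, hE⟩ := H
  refine ⟨hρ, hρd, hO, List.all_eq_true.2 fun B hB => ?_⟩
  have hB' : B < 2 ^ k := List.mem_range.1 hB
  have hk1 : 2 ^ (k + 1) ≤ 2 ^ (q - 1) := Nat.pow_le_pow_right (by norm_num) (by omega)
  have hBr : B ∈ List.range (2 ^ (q - 1) - 2 ^ k) := List.mem_range.2 (by rw [pow_succ] at hk1; omega)
  have h := List.all_eq_true.1 hE B hBr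
  rw [Nat.testBit_lt_two_pow hB', Bool.false_or] at h
  exact h

/-- **CONJECTURE D FOR EVERY TREE AT PRECISION `q` FROM A CONE-CLOSURE CERTIFICATE WITH THE R29
TARGETS** (parts 9b–9d + 10a–10b): valid split data, a passing certificate tree for every row, and
the `TTlow` row test give `s ≤ Q_t · fl_p(ŝ)` for every summation tree of nonnegative `F(q, emin)`
data, every `p ≥ 1`, any nearest roundings. -/
theorem conjectureD_of_checksLow {q : ℕ} (hq : 2 ≤ q) {data : List (List (Part × Part))}
    {rows : List (List ℤ)} {rho : List (ℕ × ℕ)} (hdata : dataValid q data = true)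
    (hrows : ∀ r ∈ rows, ∃ c, rowCheck q rows data r c = true) (htt : ttCheckLow q rows rho = true)
    {p : ℕ} (hp : 1 ≤ p) {emin : ℤ} {fl flp : ℚ → ℚ} (hfl : IsRoundNearest q emin fl)
    (hflp : IsRoundNearest p emin flp) (t : SumTree) (ht : ∀ x ∈ leaves t, IsFloat q emin x ∧ 0 ≤ x) :
    exact t ≤ treeQf (unitRoundoff q) t (unitRoundoff p) * flp (eval fl t) :=
  conjectureD_of_TTlow hp hq
    (TTlow_of_checks htt (tab_inCone (le_trans (by norm_num) hq) hdata hrows)) hfl hflp t ht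

end Summit.Ventures.CertifiedArithmetic.LowPrec.Opt
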